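import Summits.ABC.ABC.Theses.CongruentialReceptacle
import Summits.ABC.ABC.Theorems.CongruentialReceptacleAssembly
import Summits.ABC.ABC.Theorems.BalancedFreySzpiro.Negative.WithoutEps
import Summits.ABC.ABC.Theorems.CongruentialReceptacleBalancedFreySzpiroStubFreyModelSqLe
import HarnessLib

/-!
# Crux `BalancedFreySzpiro` (stmt-ABC-1723): load-bearing hypotheses and refuted strengthenings

Negative lemmas of the standing disprover (refuter-cdisprove-stmt-ABC-1723-0) for the crux of route
CongruentialReceptacle and for the hard stub of its picked line SketchIdeator1. The crux asks, for
every `κ > 0` and `ε > 0`, for a `C` with `(abc)² ≤ C · rad(abc)^(6+ε)` on all abc triples with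
`κc ≤ a`, `κc ≤ b`. It is implied by `ABC` (`Summit.ABC.ABC.Theorems.balancedFreySzpiro_of_abc`), so
no refutation short of `¬ABC` exists; what CAN be certified is which hypotheses carry weight and which
natural strengthenings are false:

* `balancedFreySzpiro_false_without_coprime` — coprimality is load-bearing: the non-coprime, perfectly
  balanced triples `2ⁿ + 2ⁿ = 2ⁿ⁺¹` have `(abc)² = 2^(6n+2)` against `rad = 2`;
* `not_balancedSzpiro_exponent_le_six`, `balancedFreySzpiro_false_exponent_six_sub` — no exponent
  `s ≤ 6` (in particular `6 − ε`) works on any window `0 < κ < 1/2`, whatever the constant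
  (from the lead's `not_balancedSzpiro_epsilon_zero`, `rad ≥ 1`);
* `balancedFreySzpiro_false_uniform_in_eps` — the constant cannot be uniform in `ε` (`∃ C ∀ ε > 0`
  fails): `ε → 0⁺` triple by triple (`le_of_forall_pos_le_mul_rpow_add`) would give the false `ε = 0`
  form; so `C(κ, ε) → ∞` as `ε → 0⁺`;
* `stubSzpiroMinimalModel_false_without_eps`, `stubSzpiroMinimalModel_false_uniform_in_eps` — the
  same two facts for the line's hard stub `stub_szpiroMinimalModel` (Szpiro for minimal integral
  models): its `ε = 0` form and its `ε`-uniform form are false, the witnesses being the global minimal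
  Frey models (landed stub `Summit.ABC.ABC.Theorems.stub_freyModelSqLe`) of the cell's balanced
  triples with `c > K · rad` (`exists_balanced_abc_triple_lt`) — Masser 1990 in the integral-model
  currency of the stub, reached from the crux's own cell;
* `cell_empty_of_half_lt`, `cell_eq_of_half` — degenerate windows: the cell is empty for `κ > 1/2`
  and is `{(1, 1, 2)}` at `κ = 1/2`, so all content sits at `0 < κ < 1/2` (and, by the proved support
  `QuarterWindowGivesCrux`, at `κ = 1/4`).

Not refutable and recorded only in the crux work file `Cruxes/BalancedFreySzpiro/Disproof.lean`:
dropping positivity (equivalent to the crux), dropping balance / making `C` uniform in `κ` (both equal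
Frey–Szpiro `6+ε` for all triples, implied by `SzpiroConjecture` and by `ABC`).
-/

set_option linter.dupNamespace false

noncomputable section

open Literature.NumberTheory.DiophantineGeometry Literature.NumberTheory.EllipticCurves
open UniqueFactorizationMonoid IsDedekindDomain
open Summit.ABC.ABC.Theses.CongruentialReceptacle
open scoped Topology
open Filter

namespace Summit.ABC.ABC.Theorems.BalancedFreySzpiro.Negative

/-! ### Coprimality is load-bearing -/

/-- `rad(2ⁿ · 2ⁿ · 2ⁿ⁺¹) = 2`. [folklore] -/
theorem rad_two_pow_two_pow (n : ℕ) : rad (2 ^ n) (2 ^ n) (2 ^ (n + 1)) = 2 := by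
  rw [rad_def, ← pow_add, ← pow_add, radical_pow_of_prime Nat.prime_two.prime (by omega)]
  simp

/-- **Coprimality is load-bearing (`BalancedFreySzpiro_false_without_coprime` shape).** The crux with
`IsABCTriple a b c` weakened to `0 < a ∧ 0 < b ∧ a + b = c` is false: the perfectly balanced
non-coprime triples `2ⁿ + 2ⁿ = 2ⁿ⁺¹` (κ = 1/2, ε = 1) have `(abc)² = 4 · 2^(6n)` against
`C · rad^7 = 128 C`. Any proof of the crux must use `Nat.Coprime a b`. [folklore] -/
theorem balancedFreySzpiro_false_without_coprime :
    ¬ ∀ κ : ℝ, 0 < κ → ∀ ε : ℝ, 0 < ε → ∃ C : ℝ, ∀ a b c : ℕ, 0 < a → 0 < b → a + b = c →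
      κ * (c : ℝ) ≤ (a : ℝ) → κ * (c : ℝ) ≤ (b : ℝ) →
        ((a * b * c : ℕ) : ℝ) ^ 2 ≤ C * ((rad a b c : ℕ) : ℝ) ^ (6 + ε) := by
  intro h
  obtain ⟨C, hC⟩ := h (1 / 2) (by norm_num) 1 one_pos
  obtain ⟨n, hn⟩ := pow_unbounded_of_one_lt (C * 2 ^ 7) (by norm_num : (1 : ℝ) < 2 ^ 6)
  rw [← pow_mul] at hn
  have hbal : (1 / 2 : ℝ) * ((2 ^ (n + 1) : ℕ) : ℝ) ≤ ((2 ^ n : ℕ) : ℝ) := by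
    push_cast; rw [pow_succ]; linarith [pow_pos (two_pos : (0:ℝ) < 2) n]
  have key := hC (2 ^ n) (2 ^ n) (2 ^ (n + 1)) (by positivity) (by positivity) (by ring) hbal hbal
  rw [rad_two_pow_two_pow, show (6 : ℝ) + 1 = ((7 : ℕ) : ℝ) by norm_num, Real.rpow_natCast] at key
  have hL : ((2 ^ n * 2 ^ n * 2 ^ (n + 1) : ℕ) : ℝ) ^ 2 = 4 * (2 : ℝ) ^ (6 * n) := by
    push_cast; ring
  rw [hL] at key
  push_cast at key
  have h6 : (0 : ℝ) < 2 ^ (6 * n) := by positivity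
  linarith

/-! ### The exponent 6 has no slack -/

/-- **No exponent `s ≤ 6` works on any window `0 < κ < 1/2`, whatever the constant:** since
`rad ≥ 1`, `rad^s ≤ rad^6`, and the `ε = 0` case is refuted (`not_balancedSzpiro_epsilon_zero`).
[new] -/
theorem not_balancedSzpiro_exponent_le_six {κ s : ℝ} (hκ0 : 0 < κ) (hκ : κ < 1 / 2) (hs : s ≤ 6) :
    ¬ ∃ C : ℝ, ∀ a b c : ℕ, IsABCTriple a b c → κ * (c : ℝ) ≤ (a : ℝ) → κ * (c : ℝ) ≤ (b : ℝ) →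
      ((a * b * c : ℕ) : ℝ) ^ 2 ≤ C * ((rad a b c : ℕ) : ℝ) ^ s := by
  rintro ⟨C, hC⟩
  refine not_balancedSzpiro_epsilon_zero hκ0 hκ ⟨max C 0, fun a b c h ha hb => ?_⟩
  have key := hC a b c h ha hb
  have hR1 : (1 : ℝ) ≤ ((rad a b c : ℕ) : ℝ) := by
    rw [rad_def]; exact_mod_cast Nat.one_le_iff_ne_zero.mpr (Nat.radical_pos _).ne'
  calc ((a * b * c : ℕ) : ℝ) ^ 2 ≤ C * ((rad a b c : ℕ) : ℝ) ^ s := key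
    _ ≤ max C 0 * ((rad a b c : ℕ) : ℝ) ^ s :=
        mul_le_mul_of_nonneg_right (le_max_left _ _) (by positivity)
    _ ≤ max C 0 * ((rad a b c : ℕ) : ℝ) ^ (6 : ℝ) :=
        mul_le_mul_of_nonneg_left (Real.rpow_le_rpow_of_exponent_le hR1 hs) (le_max_right _ _)

/-- **The crux with `6 − ε` in place of `6 + ε` is false** (κ = 1/4, ε = 1): the exponent 6 — the
precision `c₂/c₁ → 6` the route's receptacle must reach — cannot be undershot on the cell. [new] -/
theorem balancedFreySzpiro_false_exponent_six_sub :
    ¬ ∀ κ : ℝ, 0 < κ → ∀ ε : ℝ, 0 < ε → ∃ C : ℝ, ∀ a b c : ℕ, IsABCTriple a b c →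
      κ * (c : ℝ) ≤ (a : ℝ) → κ * (c : ℝ) ≤ (b : ℝ) →
        ((a * b * c : ℕ) : ℝ) ^ 2 ≤ C * ((rad a b c : ℕ) : ℝ) ^ (6 - ε) := by
  intro h
  exact not_balancedSzpiro_exponent_le_six (κ := 1 / 4) (s := 6 - 1) (by norm_num) (by norm_num)
    (by norm_num) (h (1 / 4) (by norm_num) 1 one_pos)

/-! ### The constant cannot be uniform in `ε` -/

/-- Limit lemma: an inequality `x ≤ C · R^(p+ε)` for every `ε > 0` passes to `ε = 0` (`R > 0`;
continuity of `ε ↦ R^(p+ε)` at `0`; no sign condition on `C`). [folklore] -/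
theorem le_of_forall_pos_le_mul_rpow_add {x C R p : ℝ} (hR : 0 < R)
    (h : ∀ ε : ℝ, 0 < ε → x ≤ C * R ^ (p + ε)) : x ≤ C * R ^ p := by
  have hcont : ContinuousAt (fun ε : ℝ => C * R ^ (p + ε)) 0 := by
    have h1 : ContinuousAt (fun ε : ℝ => p + ε) 0 := (continuous_const.add continuous_id).continuousAt
    have h2 : ContinuousAt (fun y : ℝ => R ^ y) (p + 0) := Real.continuousAt_const_rpow hR.ne'
    exact continuousAt_const.mul (ContinuousAt.comp (g := fun y : ℝ => R ^ y) h2 h1)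
  have ht : Tendsto (fun ε : ℝ => C * R ^ (p + ε)) (𝓝[>] 0) (𝓝 (C * R ^ p)) := by
    have := hcont.tendsto
    simp only [add_zero] at this
    exact this.mono_left nhdsWithin_le_nhds
  exact ge_of_tendsto ht (eventually_nhdsWithin_of_forall fun ε hε => h ε hε)

/-- **`C` cannot be uniform in `ε` (`BalancedFreySzpiro` with `∃ C ∀ ε > 0` is false):** letting
`ε → 0⁺` triple by triple would give the `ε = 0` inequality with the same constant, refuted on the
window `κ = 1/4` by `not_balancedSzpiro_epsilon_zero`. Hence `C(κ, ε) → ∞` as `ε → 0⁺` (the rate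
on the cell is open: the certified balanced witnesses are doubly exponential in the excess). [new] -/
theorem balancedFreySzpiro_false_uniform_in_eps :
    ¬ ∀ κ : ℝ, 0 < κ → ∃ C : ℝ, ∀ ε : ℝ, 0 < ε → ∀ a b c : ℕ, IsABCTriple a b c →
      κ * (c : ℝ) ≤ (a : ℝ) → κ * (c : ℝ) ≤ (b : ℝ) →
        ((a * b * c : ℕ) : ℝ) ^ 2 ≤ C * ((rad a b c : ℕ) : ℝ) ^ (6 + ε) := by
  intro h
  obtain ⟨C, hC⟩ := h (1 / 4) (by norm_num)
  refine not_balancedSzpiro_epsilon_zero (κ := 1 / 4) (by norm_num) (by norm_num)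
    ⟨C, fun a b c ht ha hb => ?_⟩
  have hR : (0 : ℝ) < ((rad a b c : ℕ) : ℝ) := by
    rw [rad_def]; exact_mod_cast Nat.radical_pos _
  exact le_of_forall_pos_le_mul_rpow_add hR fun ε hε => hC ε hε a b c ht ha hb

/-! ### Line SketchIdeator1: the hard stub's `ε` is load-bearing -/

/-- **`stub_szpiroMinimalModel` with `ε = 0` is false (`stub_szpiroMinimalModel_false_without_eps`
shape):** there is no `C` with `|Δ(W₀)| ≤ C · N^6` for all minimal integral models `W₀` (elliptic
over `ℚ`, minimal at every prime, `N` the conductor). Witnesses: the global minimal Frey models of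
the cell's balanced triples with `c > K · rad(abc)` (`exists_balanced_abc_triple_lt` at κ = 1/4,
`K = 2¹³ max(C,1)`), through the landed stub `stub_freyModelSqLe` (`N ∣ 2¹⁰ rad`, `(abc)² ≤ 2⁸|Δ|`):
`|Δ| ≥ (abc)²/2⁸ ≥ c⁶/2¹⁶ > K⁶ rad⁶/2¹⁶ ≥ K⁶ N⁶/2⁷⁶`. This is Masser's `ε = 0` remark in the
integral-model currency of the stub (the tree's `W/ℚ` currency:
`Literature.Barriers.ABC.not_szpiro_epsilon_zero_holds`). [cite: Masser1990, p. 19] -/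
theorem stubSzpiroMinimalModel_false_without_eps :
    ¬ ∃ C : ℝ, ∀ W₀ : WeierstrassCurve ℤ, (W₀.baseChange ℚ).IsElliptic →
      (∀ v : HeightOneSpectrum ℤ, (W₀.baseChange ℚ).IsMinimalAt v) →
        (|W₀.Δ| : ℝ) ≤ C * (((W₀.baseChange ℚ).conductorNorm ℤ : ℕ) : ℝ) ^ (6 : ℝ) := by
  rintro ⟨C, hC⟩
  set C' : ℝ := max C 1 with hC'
  have hC'1 : 1 ≤ C' := le_max_right _ _
  have hC'0 : 0 < C' := by linarith
  set K : ℝ := 2 ^ 13 * C' with hK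
  obtain ⟨a, b, c, ht, ha, hb, hlt⟩ := exists_balanced_abc_triple_lt (1 / 4) K (by norm_num)
  obtain ⟨W₀, hE, hmin, hN, hsq⟩ := stub_freyModelSqLe a b c ht
  have key := hC W₀ hE hmin
  set N : ℝ := (((W₀.baseChange ℚ).conductorNorm ℤ : ℕ) : ℝ) with hNdef
  set R : ℝ := ((rad a b c : ℕ) : ℝ) with hRdef
  have hN0 : 0 ≤ N := by positivity
  have hR0 : 0 < R := by rw [hRdef, rad_def]; exact_mod_cast Nat.radical_pos _
  have hrpow : N ^ (6 : ℝ) = N ^ (6 : ℕ) := by exact_mod_cast Real.rpow_natCast N 6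
  rw [hrpow] at key
  have hNR : N ≤ 2 ^ 10 * R := by
    have := Nat.le_of_dvd (mul_pos (by positivity) (by rw [rad_def]; exact Nat.radical_pos _)) hN
    rw [hNdef, hRdef]; exact_mod_cast this
  have hsq' : ((a * b * c : ℕ) : ℝ) ^ 2 ≤ 2 ^ 8 * (|W₀.Δ| : ℝ) := by
    have : (((a * b * c : ℕ) : ℤ) : ℝ) ^ 2 ≤ ((2 ^ 8 * |W₀.Δ| : ℤ) : ℝ) := by exact_mod_cast hsq
    push_cast at this ⊢
    linarith
  have hlow : (1 / 4 : ℝ) ^ 4 * (c : ℝ) ^ 6 ≤ ((a * b * c : ℕ) : ℝ) ^ 2 :=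
    balanced_pow_six_le (by norm_num) ha hb
  have hup : ((a * b * c : ℕ) : ℝ) ^ 2 ≤ 2 ^ 8 * C' * (2 ^ 10 * R) ^ 6 := by
    have h1 : (|W₀.Δ| : ℝ) ≤ C' * N ^ 6 :=
      key.trans (mul_le_mul_of_nonneg_right (le_max_left _ _) (by positivity))
    have h2 : C' * N ^ 6 ≤ C' * (2 ^ 10 * R) ^ 6 :=
      mul_le_mul_of_nonneg_left (pow_le_pow_left₀ hN0 hNR 6) hC'0.le
    linarith
  have hKR : 0 ≤ K * R := by positivity
  have hc6 : (K * R) ^ 6 < (c : ℝ) ^ 6 := pow_lt_pow_left₀ hlt hKR (by norm_num)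
  have h4 : (1 / 4 : ℝ) ^ 4 * (K * R) ^ 6 < 2 ^ 8 * C' * (2 ^ 10 * R) ^ 6 :=
    lt_of_lt_of_le (mul_lt_mul_of_pos_left hc6 (by norm_num)) (hlow.trans hup)
  have h5 : (1 / 4 : ℝ) ^ 4 * (K * R) ^ 6 = 2 ^ 70 * C' ^ 6 * R ^ 6 := by rw [hK]; ring
  have h6 : (2 : ℝ) ^ 8 * C' * (2 ^ 10 * R) ^ 6 = 2 ^ 68 * C' * R ^ 6 := by ring
  rw [h5, h6] at h4
  have hR6 : 0 < R ^ 6 := by positivity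
  have h7 : (2 : ℝ) ^ 70 * C' ^ 6 < 2 ^ 68 * C' := lt_of_mul_lt_mul_right h4 hR6.le
  have h8 : C' ≤ C' ^ 6 := by
    calc C' = C' ^ 1 := (pow_one _).symm
      _ ≤ C' ^ 6 := pow_le_pow_right₀ hC'1 (by norm_num)
  nlinarith

/-- **Nor can the hard stub's constant be uniform in `ε`** (`∃ C ∀ ε > 0 ∀ W₀ …` is false): `ε → 0⁺`
curve by curve gives the refuted `ε = 0` form (conductor `0`, if it occurred, is harmless:
`0^(6+ε) = 0 = 0^6`). [new] -/
theorem stubSzpiroMinimalModel_false_uniform_in_eps :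
    ¬ ∃ C : ℝ, ∀ ε : ℝ, 0 < ε → ∀ W₀ : WeierstrassCurve ℤ, (W₀.baseChange ℚ).IsElliptic →
      (∀ v : HeightOneSpectrum ℤ, (W₀.baseChange ℚ).IsMinimalAt v) →
        (|W₀.Δ| : ℝ) ≤ C * (((W₀.baseChange ℚ).conductorNorm ℤ : ℕ) : ℝ) ^ (6 + ε) := by
  rintro ⟨C, hC⟩
  refine stubSzpiroMinimalModel_false_without_eps ⟨C, fun W₀ hE hmin => ?_⟩
  rcases Nat.eq_zero_or_pos ((W₀.baseChange ℚ).conductorNorm ℤ) with h0 | hpos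
  · have h1 := hC 1 one_pos W₀ hE hmin
    rw [h0, Nat.cast_zero, Real.zero_rpow (by norm_num)] at h1
    rw [h0, Nat.cast_zero, Real.zero_rpow (by norm_num)]
    exact h1
  · exact le_of_forall_pos_le_mul_rpow_add (by exact_mod_cast hpos) fun ε hε => hC ε hε W₀ hE hmin

/-! ### Degenerate windows -/

/-- **The cell is EMPTY for `κ > 1/2`** (`a + b = c` forces `min(a, b) ≤ c/2`): there the crux holds
vacuously, with any constant. [folklore] -/
theorem cell_empty_of_half_lt {κ : ℝ} (hκ : 1 / 2 < κ) {a b c : ℕ} (h : IsABCTriple a b c)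
    (ha : κ * (c : ℝ) ≤ (a : ℝ)) (hb : κ * (c : ℝ) ≤ (b : ℝ)) : False := by
  obtain ⟨ha0, _, hsum, -⟩ := h
  have hc : (c : ℝ) = a + b := by exact_mod_cast hsum.symm
  have ha' : (0 : ℝ) < a := by exact_mod_cast ha0
  nlinarith

/-- **At `κ = 1/2` the cell is the single triple `(1, 1, 2)`** (`a = b = c/2`, coprime). So all content
of the crux sits at `0 < κ < 1/2` (and by the proved support `QuarterWindowGivesCrux` at `κ = 1/4`).
[folklore] -/
theorem cell_eq_of_half {a b c : ℕ} (h : IsABCTriple a b c)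
    (ha : (1 / 2 : ℝ) * (c : ℝ) ≤ (a : ℝ)) (hb : (1 / 2 : ℝ) * (c : ℝ) ≤ (b : ℝ)) :
    a = 1 ∧ b = 1 ∧ c = 2 := by
  obtain ⟨_, _, hsum, hcop⟩ := h
  have hc : (c : ℝ) = a + b := by exact_mod_cast hsum.symm
  have hab : (a : ℝ) = b := by linarith
  have hab' : a = b := by exact_mod_cast hab
  subst hab'
  have ha1 : a = 1 := by simpa using hcop
  subst ha1
  omega

end Summit.ABC.ABC.Theorems.BalancedFreySzpiro.Negative

end
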